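import Summits.HubbardSuperconductivity.HubbardSuperconductivity.Theorems.SoloBlindCertificateFromGroundGap
import HarnessLib

/-!
# The primal form of a proof: trial subspaces exhausting the ground multiplet

`SoloBlindCertificateForm` / `SoloBlindCertificateFromGroundGap` give the DUAL shape of any proof
of `HubbardSuperconductivity` (a PSD certificate on the doped sector, multiplier `~ L⁴/γ_L`). This
file proves the PRIMAL shape — what a constructive (variational) proof must deliver on each large
even torus — and that it, too, is EQUIVALENT to the summit.

Fix the sector `S`, the Hermitian `H`, the ground energy `E₀`, the ground eigenspace
`V = {ψ ∈ S | Hψ = E₀ψ}` and a TRIAL SUBSPACE `T`. Three properties: ORDER on `T`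
(`a‖φ‖² ≤ ‖Δφ‖²`, `a = cL⁴`); COVER (no ground state is orthogonal to `T`, i.e. `P_V T = V`;
under CLOSENESS this is the dimension count `dim T ≥ dim V` — "no accidental ground states outside
the trial family"); CLOSENESS (`‖φ - P_V φ‖² ≤ ε‖φ‖²` on `T`, stated projection-free), which a
VARIATIONAL ENERGY BOUND `re⟨φ,Hφ⟩ ≤ (E₀+η)‖φ‖²` on `T` plus a GAP `γ` of `H` above `V` inside `S`
deliver with `ε = η/γ` (`trial_close_of_energy_gap`).

* `exists_starProjection_eq_of_cover`, `exists_trial_of_cover` — COVER `⟹` every ground state is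
  the `V`-component of a trial vector.
* `groundState_order_of_close_cover` — ORDER `a` + COVER + CLOSENESS `ε` + `‖Δw‖² ≤ B‖w‖²` give
  ORDER `a/2 - Bε` on EVERY ground state.
* `groundState_dWave_order_of_closeTrialSubspace`, `groundState_dWave_order_of_trialSubspace` —
  Hubbard torus (`B = 400L⁴`, `pairField_order_le`): `1600ε ≤ c` (resp. `1600η ≤ cγ`) and order
  `cL⁴` on `T` give order `(c/4)L⁴` on every ground state of the sector.
* `hubbardSuperconductivity_iff_closeTrialSubspaces` — THE SUMMIT IS EQUIVALENT to: for some
  `U > 0`, `δ ∈ (0,1/2)`, `c > 0` and all large even `L`, the doped `S^z = 0` sector admits a trial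
  subspace with ORDER `cL⁴`, COVER and CLOSENESS `c/1600` (the converse takes `T = V`).
* `hubbardSuperconductivity_of_trialSubspaces` — the variational blueprint: `T_L ≤ S_L` with
  d-wave order `cL⁴`, energies `≤ E₀ + η_L`, a gap `γ_L` above the ground multiplet,
  `1600η_L ≤ cγ_L`, and COVER, imply `HubbardSuperconductivity`.

Reading. By `SoloBlindGaugeTwist`/`SoloBlindTwistMomentum` the twisted ground state lies in the
sector at energy `≤ E₀ + 16π²|t|` (generically in another momentum class), so `γ_L = O(|t|)` and
physically `O(|t|/L)`: the blueprint demands trial states whose TOTAL energy error is `o(γ_L)` —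
an accuracy no existing variational or perturbative method provides for interacting lattice
fermions in `d = 2` (requirements R1/R4 of the obstruction report, in constructive form).
References: Reed–Simon IV §XIII.1; Horn–Johnson, *Matrix Analysis* §4.3; `Submodule.starProjection`.
-/

namespace Summit.HubbardSuperconductivity.HubbardSuperconductivity.Theorems

open Matrix Finset Literature.MathematicalPhysics.QuantumLattice
  Literature.MathematicalPhysics.QuantumFieldTheory GaugeTwist WithLp
open scoped ComplexConjugate ComplexOrder InnerProductSpace

section Abstract

variable {n : Type*} [Fintype n]

/-- **Cover ⟹ exhaustion** (Hilbert-space form). If no nonzero vector of `V` is orthogonal to `T`,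
every `ψ ∈ V` is the `V`-component of some `φ ∈ T`: `P_V φ = ψ`. (`M = P_V T ≤ V`; the component
of `ψ` orthogonal to `M` is orthogonal to `T`, hence zero.) [folklore] -/
theorem exists_starProjection_eq_of_cover (V T : Submodule ℂ (EuclideanSpace ℂ n))
    (hcover : ∀ ψ ∈ V, (∀ φ ∈ T, ⟪φ, ψ⟫_ℂ = 0) → ψ = 0) {ψ : EuclideanSpace ℂ n} (hψ : ψ ∈ V) :
    ∃ φ ∈ T, V.starProjection φ = ψ := by
  let f : EuclideanSpace ℂ n →ₗ[ℂ] EuclideanSpace ℂ n :=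
    (V.starProjection : EuclideanSpace ℂ n →L[ℂ] EuclideanSpace ℂ n).toLinearMap
  have hf : ∀ x, f x = V.starProjection x := fun _ => rfl
  let M : Submodule ℂ (EuclideanSpace ℂ n) := T.map f
  have hMV : M ≤ V := by
    rintro x ⟨y, -, rfl⟩
    exact hf y ▸ V.starProjection_apply_mem y
  have hmM : M.starProjection ψ ∈ M := M.starProjection_apply_mem ψ
  have hr : ψ - M.starProjection ψ ∈ Mᗮ := M.sub_starProjection_mem_orthogonal ψ
  have hrV : ψ - M.starProjection ψ ∈ V := V.sub_mem hψ (hMV hmM)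
  have hr0 : ψ - M.starProjection ψ = 0 := by
    refine hcover _ hrV fun φ hφ => ?_
    have hPφ : V.starProjection φ ∈ M := hf φ ▸ Submodule.mem_map_of_mem hφ
    calc ⟪φ, ψ - M.starProjection ψ⟫_ℂ
        = ⟪φ, V.starProjection (ψ - M.starProjection ψ)⟫_ℂ := by
          rw [Submodule.starProjection_eq_self_iff.mpr hrV]
      _ = ⟪V.starProjection φ, ψ - M.starProjection ψ⟫_ℂ :=
          (Submodule.inner_starProjection_left_eq_right V φ _).symm
      _ = 0 := (Submodule.mem_orthogonal M _).1 hr _ hPφ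
  obtain ⟨φ, hφT, hφ⟩ := hmM
  refine ⟨φ, hφT, ?_⟩
  rw [← hf, hφ]
  exact (sub_eq_zero.1 hr0).symm

/-- **Cover ⟹ exhaustion** (`dotProduct` form). With `V = {ψ ∈ S | Hψ = E₀ψ}`: if no nonzero
`ψ ∈ V` is orthogonal to the trial space `T`, then for every `ψ ∈ V` there is `φ ∈ T` with
`φ - ψ ⊥ V` (i.e. `ψ = P_V φ`). [folklore] -/
theorem exists_trial_of_cover (H : Matrix n n ℂ) (S T : Submodule ℂ (n → ℂ)) (E₀ : ℝ)
    (hcover : ∀ ψ ∈ S, H *ᵥ ψ = (E₀ : ℂ) • ψ → (∀ φ ∈ T, star φ ⬝ᵥ ψ = 0) → ψ = 0)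
    {ψ : n → ℂ} (hψS : ψ ∈ S) (hψ : H *ᵥ ψ = (E₀ : ℂ) • ψ) :
    ∃ φ ∈ T, ∀ ψ' ∈ S, H *ᵥ ψ' = (E₀ : ℂ) • ψ' → star ψ' ⬝ᵥ (φ - ψ) = 0 := by
  let K : Submodule ℂ (EuclideanSpace ℂ n) :=
    { carrier := {x | ofLp x ∈ S ∧ H *ᵥ ofLp x = (E₀ : ℂ) • ofLp x}
      zero_mem' := by simp
      add_mem' := by
        rintro x y ⟨hxS, hx⟩ ⟨hyS, hy⟩
        exact ⟨by rw [ofLp_add]; exact S.add_mem hxS hyS,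
          by rw [ofLp_add, mulVec_add, hx, hy, smul_add]⟩
      smul_mem' := by
        rintro c x ⟨hxS, hx⟩
        exact ⟨by rw [ofLp_smul]; exact S.smul_mem c hxS,
          by rw [ofLp_smul, mulVec_smul, hx, smul_comm]⟩ }
  have hmem : ∀ y : EuclideanSpace ℂ n, y ∈ K ↔ ofLp y ∈ S ∧ H *ᵥ ofLp y = (E₀ : ℂ) • ofLp y :=
    fun _ => Iff.rfl
  let T' : Submodule ℂ (EuclideanSpace ℂ n) :=
    { carrier := {x | ofLp x ∈ T}
      zero_mem' := by simp
      add_mem' := fun {x y} hx hy => by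
        simp only [Set.mem_setOf_eq] at hx hy ⊢
        rw [ofLp_add]; exact T.add_mem hx hy
      smul_mem' := fun c {x} hx => by
        simp only [Set.mem_setOf_eq] at hx ⊢
        rw [ofLp_smul]; exact T.smul_mem c hx }
  have hmemT : ∀ y : EuclideanSpace ℂ n, y ∈ T' ↔ ofLp y ∈ T := fun _ => Iff.rfl
  have hcov' : ∀ x ∈ K, (∀ y ∈ T', ⟪y, x⟫_ℂ = 0) → x = 0 := by
    intro x hx hperp
    rw [hmem] at hx
    have h0 : ofLp x = 0 := by
      refine hcover (ofLp x) hx.1 hx.2 fun φ hφ => ?_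
      have h := hperp (toLp 2 φ) (by rw [hmemT, ofLp_toLp]; exact hφ)
      rwa [EuclideanSpace.inner_eq_star_dotProduct, dotProduct_comm, ofLp_toLp] at h
    calc x = toLp 2 (ofLp x) := rfl
      _ = 0 := by rw [h0, toLp_zero]
  have hψK : (toLp 2 ψ : EuclideanSpace ℂ n) ∈ K := by
    rw [hmem, ofLp_toLp]; exact ⟨hψS, hψ⟩
  obtain ⟨φ', hφ'T, hP⟩ := exists_starProjection_eq_of_cover K T' hcov' hψK
  refine ⟨ofLp φ', hφ'T, fun ψ' hψ'S hψ' => ?_⟩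
  have hw : φ' - K.starProjection φ' ∈ Kᗮ := K.sub_starProjection_mem_orthogonal φ'
  rw [hP] at hw
  have hψ'K : (toLp 2 ψ' : EuclideanSpace ℂ n) ∈ K := by
    rw [hmem, ofLp_toLp]; exact ⟨hψ'S, hψ'⟩
  have h0 := (Submodule.mem_orthogonal K _).1 hw _ hψ'K
  rwa [EuclideanSpace.inner_eq_star_dotProduct, dotProduct_comm, ofLp_toLp, ofLp_sub,
    ofLp_toLp] at h0

/-- **Primal transfer** (abstract). A trial subspace `T` with ORDER `a` (`a‖φ‖² ≤ ‖Aφ‖²`), COVER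
(no nonzero ground state `⊥ T`) and CLOSENESS `ε` to the ground eigenspace `V = {ψ ∈ S | Hψ = E₀ψ}`
(`‖φ - P_V φ‖² ≤ ε‖φ‖²`, stated projection-free), with the operator bound `‖Aw‖² ≤ B‖w‖²`, forces
ORDER `a/2 - Bε` on every ground state. [this work] -/
theorem groundState_order_of_close_cover (H A : Matrix n n ℂ) (S T : Submodule ℂ (n → ℂ))
    (E₀ a B ε : ℝ) (hB0 : 0 ≤ B)
    (hB : ∀ w, (star (A *ᵥ w) ⬝ᵥ (A *ᵥ w)).re ≤ B * (star w ⬝ᵥ w).re)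
    (hord : ∀ φ ∈ T, a * (star φ ⬝ᵥ φ).re ≤ (star (A *ᵥ φ) ⬝ᵥ (A *ᵥ φ)).re)
    (hcover : ∀ ψ ∈ S, H *ᵥ ψ = (E₀ : ℂ) • ψ → (∀ φ ∈ T, star φ ⬝ᵥ ψ = 0) → ψ = 0)
    (hclose : ∀ φ ∈ T, ∀ u ∈ S, u ≠ 0 → H *ᵥ u = (E₀ : ℂ) • u →
      (∀ ψ' ∈ S, H *ᵥ ψ' = (E₀ : ℂ) • ψ' → star ψ' ⬝ᵥ (φ - u) = 0) →
        (star (φ - u) ⬝ᵥ (φ - u)).re ≤ ε * (star φ ⬝ᵥ φ).re) :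
    ∀ ψ ∈ S, H *ᵥ ψ = (E₀ : ℂ) • ψ →
      (a / 2 - B * ε) * (star ψ ⬝ᵥ ψ).re ≤ (star (A *ᵥ ψ) ⬝ᵥ (A *ᵥ ψ)).re := by
  intro ψ hψS hψ
  by_cases hψ0 : ψ = 0
  · subst hψ0; simp
  obtain ⟨φ, hφT, hw⟩ := exists_trial_of_cover H S T E₀ hcover hψS hψ
  have horth : star ψ ⬝ᵥ (φ - ψ) = 0 := hw ψ hψS hψ
  have hcl := hclose φ hφT ψ hψS hψ0 hψ hw
  set w := φ - ψ with hwdef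
  have h1 := half_re_self_sub_le_re_add_self (A *ᵥ φ) (A *ᵥ (-w))
  rw [← mulVec_add, show φ + -w = ψ by rw [hwdef]; abel, mulVec_neg, star_neg, neg_dotProduct,
    dotProduct_neg, neg_neg] at h1
  have hre : (star ψ ⬝ᵥ w).re = 0 := by rw [horth, Complex.zero_re]
  have hnorm := re_add_self_of_orthogonal ψ w hre
  rw [show ψ + w = φ by rw [hwdef]; abel] at hnorm
  have hBw : B * (star w ⬝ᵥ w).re ≤ B * (ε * (star φ ⬝ᵥ φ).re) :=
    mul_le_mul_of_nonneg_left hcl hB0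
  have hψ0 : 0 ≤ (star ψ ⬝ᵥ ψ).re := (Complex.nonneg_iff.mp (dotProduct_star_self_nonneg _)).1
  have hw0 : 0 ≤ (star w ⬝ᵥ w).re := (Complex.nonneg_iff.mp (dotProduct_star_self_nonneg _)).1
  have hAψ0 : 0 ≤ (star (A *ᵥ ψ) ⬝ᵥ (A *ᵥ ψ)).re :=
    (Complex.nonneg_iff.mp (dotProduct_star_self_nonneg _)).1
  by_cases hs : 0 ≤ a / 2 - B * ε
  · have : (a / 2 - B * ε) * (star ψ ⬝ᵥ ψ).re ≤ (a / 2 - B * ε) * (star φ ⬝ᵥ φ).re :=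
      mul_le_mul_of_nonneg_left (by linarith) hs
    nlinarith [hB w, hord φ hφT]
  · linarith [mul_le_mul_of_nonneg_right (not_le.mp hs).le hψ0]

/-- **Closeness from a variational energy bound and a gap.** If `T ≤ S`, every `φ ∈ T` has
`re⟨φ,Hφ⟩ - E₀‖φ‖² ≤ η‖φ‖²`, and the Hermitian `H` has the variational gap `γ > 0` above its
`E₀`-eigenvectors inside `S`, then `‖φ - P_V φ‖² ≤ (η/γ)‖φ‖²` for `φ ∈ T`. [folklore] -/
theorem trial_close_of_energy_gap {H : Matrix n n ℂ} (hH : H.IsHermitian)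
    (S T : Submodule ℂ (n → ℂ)) (hTS : T ≤ S) (E₀ η γ : ℝ) (hγ : 0 < γ)
    (henergy : ∀ φ ∈ T,
      (star φ ⬝ᵥ (H *ᵥ φ)).re - E₀ * (star φ ⬝ᵥ φ).re ≤ η * (star φ ⬝ᵥ φ).re)
    (hgap : ∀ w ∈ S, (∀ ψ ∈ S, H *ᵥ ψ = (E₀ : ℂ) • ψ → star ψ ⬝ᵥ w = 0) →
      γ * (star w ⬝ᵥ w).re ≤ (star w ⬝ᵥ (H *ᵥ w)).re - E₀ * (star w ⬝ᵥ w).re) :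
    ∀ φ ∈ T, ∀ u ∈ S, H *ᵥ u = (E₀ : ℂ) • u →
      (∀ ψ' ∈ S, H *ᵥ ψ' = (E₀ : ℂ) • ψ' → star ψ' ⬝ᵥ (φ - u) = 0) →
        (star (φ - u) ⬝ᵥ (φ - u)).re ≤ η / γ * (star φ ⬝ᵥ φ).re := by
  intro φ hφT u huS hu hw
  have hwS : φ - u ∈ S := S.sub_mem (hTS hφT) huS
  have hEn := re_energy_above_eigen_add_orthogonal hH u (φ - u) E₀ hu (hw u huS hu)
  rw [add_sub_cancel] at hEn
  rw [div_mul_eq_mul_div, le_div_iff₀ hγ]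
  linarith [hgap (φ - u) hwS hw, henergy φ hφT]

end Abstract

section Hubbard

variable {L : ℕ} [NeZero L]

/-- **Primal transfer on the Hubbard torus, closeness form.** Sector `S`, trial subspace `T`, form
factor `|g| ≤ 1`, any `t, U, E₀`; ORDER `cL⁴` on `T`, COVER, CLOSENESS `ε`, `1600ε ≤ c`: every
`E₀`-eigenvector of `H` in `S` has pair-field order `≥ (c/4)L⁴‖ψ‖²`. [this work] -/
theorem groundState_dWave_order_of_closeTrialSubspace (t U E₀ c ε : ℝ) (hεc : 1600 * ε ≤ c)
    (g : (Fin 2 → ℤ) → ℝ) (hg : ∀ e, |g e| ≤ 1)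
    (S T : Submodule ℂ (Fock (Orb (FermionTorus 2 L))))
    (hord : ∀ φ ∈ T, c * (L : ℝ) ^ 4 * (star φ ⬝ᵥ φ).re ≤
      (star (pairField g L *ᵥ φ) ⬝ᵥ (pairField g L *ᵥ φ)).re)
    (hcover : ∀ ψ ∈ S, hubbardTorus 2 L t U *ᵥ ψ = (E₀ : ℂ) • ψ →
      (∀ φ ∈ T, star φ ⬝ᵥ ψ = 0) → ψ = 0)
    (hclose : ∀ φ ∈ T, ∀ u ∈ S, u ≠ 0 → hubbardTorus 2 L t U *ᵥ u = (E₀ : ℂ) • u →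
      (∀ ψ' ∈ S, hubbardTorus 2 L t U *ᵥ ψ' = (E₀ : ℂ) • ψ' → star ψ' ⬝ᵥ (φ - u) = 0) →
        (star (φ - u) ⬝ᵥ (φ - u)).re ≤ ε * (star φ ⬝ᵥ φ).re) :
    ∀ ψ ∈ S, hubbardTorus 2 L t U *ᵥ ψ = (E₀ : ℂ) • ψ →
      c / 4 * (L : ℝ) ^ 4 * (star ψ ⬝ᵥ ψ).re ≤
        (star (pairField g L *ᵥ ψ) ⬝ᵥ (pairField g L *ᵥ ψ)).re := by
  intro ψ hψS hψ
  have h := groundState_order_of_close_cover (hubbardTorus 2 L t U) (pairField g L) S T E₀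
    (c * (L : ℝ) ^ 4) (400 * (L : ℝ) ^ 4) ε (by positivity) (pairField_order_le g hg) hord hcover
    hclose ψ hψS hψ
  have hL4 : (0 : ℝ) ≤ (L : ℝ) ^ 4 := by positivity
  have hcoef : c / 4 * (L : ℝ) ^ 4 ≤ c * (L : ℝ) ^ 4 / 2 - 400 * (L : ℝ) ^ 4 * ε := by
    nlinarith
  exact (mul_le_mul_of_nonneg_right hcoef
    (Complex.nonneg_iff.mp (dotProduct_star_self_nonneg _)).1).trans h

/-- **Primal transfer on the Hubbard torus, variational form.** Sector `S`, trial subspace `T ≤ S`,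
form factor `|g| ≤ 1`, any `t, U, E₀`; ORDER `cL⁴` on `T`, energies `re⟨φ,Hφ⟩ ≤ (E₀+η)‖φ‖²` on
`T`, a variational gap `γ > 0` above the `E₀`-eigenvectors inside `S`, `1600η ≤ cγ`, and COVER:
every `E₀`-eigenvector of `H` in `S` has pair-field order `≥ (c/4)L⁴‖ψ‖²`. [this work] -/
theorem groundState_dWave_order_of_trialSubspace (t U E₀ c η γ : ℝ) (hγ : 0 < γ)
    (hηγ : 1600 * η ≤ c * γ) (g : (Fin 2 → ℤ) → ℝ) (hg : ∀ e, |g e| ≤ 1)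
    (S T : Submodule ℂ (Fock (Orb (FermionTorus 2 L)))) (hTS : T ≤ S)
    (henergy : ∀ φ ∈ T, (star φ ⬝ᵥ (hubbardTorus 2 L t U *ᵥ φ)).re - E₀ * (star φ ⬝ᵥ φ).re ≤
      η * (star φ ⬝ᵥ φ).re)
    (hord : ∀ φ ∈ T, c * (L : ℝ) ^ 4 * (star φ ⬝ᵥ φ).re ≤
      (star (pairField g L *ᵥ φ) ⬝ᵥ (pairField g L *ᵥ φ)).re)
    (hgap : ∀ w ∈ S, (∀ ψ ∈ S, hubbardTorus 2 L t U *ᵥ ψ = (E₀ : ℂ) • ψ → star ψ ⬝ᵥ w = 0) →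
      γ * (star w ⬝ᵥ w).re ≤
        (star w ⬝ᵥ (hubbardTorus 2 L t U *ᵥ w)).re - E₀ * (star w ⬝ᵥ w).re)
    (hcover : ∀ ψ ∈ S, hubbardTorus 2 L t U *ᵥ ψ = (E₀ : ℂ) • ψ →
      (∀ φ ∈ T, star φ ⬝ᵥ ψ = 0) → ψ = 0) :
    ∀ ψ ∈ S, hubbardTorus 2 L t U *ᵥ ψ = (E₀ : ℂ) • ψ →
      c / 4 * (L : ℝ) ^ 4 * (star ψ ⬝ᵥ ψ).re ≤
        (star (pairField g L *ᵥ ψ) ⬝ᵥ (pairField g L *ᵥ ψ)).re := by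
  have hεc : 1600 * (η / γ) ≤ c := by
    rw [mul_div_assoc', div_le_iff₀ hγ]; exact hηγ
  exact groundState_dWave_order_of_closeTrialSubspace t U E₀ c (η / γ) hεc g hg S T hord hcover
    fun φ hφ u huS _ hu hw => trial_close_of_energy_gap (isHermitian_hubbardTorus L t U) S T hTS
      E₀ η γ hγ henergy hgap φ hφ u huS hu hw

end Hubbard

/-! ### The summit in primal form -/

/-- **`HubbardSuperconductivity` ⟺ close covering trial subspaces with d-wave order.** The summit
holds iff for some `U > 0`, `δ ∈ (0,1/2)`, `c > 0`, `L₀`, at every even side `L = n+1 ≥ L₀` — with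
`H = hubbardTorus 2 L 1 U` and the ground states of the sector `(2⌊(1-δ)L²/2⌋, S^z = 0)` — there is
a trial subspace `T` of Fock space with: ORDER `cL⁴‖φ‖² ≤ re⟨φ, (√2Δ_d)†(√2Δ_d)φ⟩` on `T`; COVER
(every sector ground state has nonzero overlap with `T`); CLOSENESS (for `φ ∈ T` and any sector
ground state `u` with `φ - u ⊥` all ground states, `‖φ - u‖² ≤ (c/1600)‖φ‖²`). (`⟸`: the primal
transfer and the finite-volume criterion; `⟹`: take `T` = the ground eigenspace.) [this work] -/
theorem hubbardSuperconductivity_iff_closeTrialSubspaces :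
    HubbardSuperconductivity ↔
      ∃ U : ℝ, 0 < U ∧ ∃ δ ∈ Set.Ioo (0 : ℝ) (1 / 2), ∃ c : ℝ, 0 < c ∧ ∃ L₀ : ℕ,
        ∀ n : ℕ, Even (n + 1) → L₀ ≤ n + 1 →
          ∃ T : Submodule ℂ (Fock (Orb (FermionTorus 2 (n + 1)))),
            (∀ φ ∈ T, c * ((n + 1 : ℕ) : ℝ) ^ 4 * (star φ ⬝ᵥ φ).re ≤ (expect
              ((pairField dWaveFormFactor (n + 1))ᴴ * pairField dWaveFormFactor (n + 1)) φ).re) ∧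
            (∀ ψ, IsGroundStateInSector (hubbardTorus 2 (n + 1) 1 U)
                (2 * ⌊(1 - δ) * ((n + 1 : ℕ) : ℝ) ^ 2 / 2⌋₊) 0 ψ →
              ∃ φ ∈ T, star φ ⬝ᵥ ψ ≠ 0) ∧
            (∀ φ ∈ T, ∀ u, IsGroundStateInSector (hubbardTorus 2 (n + 1) 1 U)
                (2 * ⌊(1 - δ) * ((n + 1 : ℕ) : ℝ) ^ 2 / 2⌋₊) 0 u →
              (∀ ψ', IsGroundStateInSector (hubbardTorus 2 (n + 1) 1 U)
                  (2 * ⌊(1 - δ) * ((n + 1 : ℕ) : ℝ) ^ 2 / 2⌋₊) 0 ψ' → star ψ' ⬝ᵥ (φ - u) = 0) →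
              (star (φ - u) ⬝ᵥ (φ - u)).re ≤ c / 1600 * (star φ ⬝ᵥ φ).re) := by
  rw [hubbardSuperconductivity_iff_uniform_dWave_bound]
  constructor
  · rintro ⟨U, hU, δ, hδ, c, hc, L₀, hb⟩
    refine ⟨U, hU, δ, hδ, c, hc, L₀, fun n hn hL => ?_⟩
    set H := hubbardTorus 2 (n + 1) 1 U
    set N : ℕ := 2 * ⌊(1 - δ) * ((n + 1 : ℕ) : ℝ) ^ 2 / 2⌋₊ with hN
    let V : Submodule ℂ (Fock (Orb (FermionTorus 2 (n + 1)))) :=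
      { carrier := {ψ | ψ ∈ szSector N 0 ∧ H *ᵥ ψ = ((H.minEnergyOn (szSector N 0) : ℝ) : ℂ) • ψ}
        zero_mem' := by simp
        add_mem' := by
          rintro x y ⟨hxS, hx⟩ ⟨hyS, hy⟩
          exact ⟨Submodule.add_mem _ hxS hyS, by rw [mulVec_add, hx, hy, smul_add]⟩
        smul_mem' := by
          rintro a x ⟨hxS, hx⟩
          exact ⟨Submodule.smul_mem _ a hxS, by rw [mulVec_smul, hx, smul_comm]⟩ }
    have hmem : ∀ ψ, ψ ∈ V ↔
        ψ ∈ szSector N 0 ∧ H *ᵥ ψ = ((H.minEnergyOn (szSector N 0) : ℝ) : ℂ) • ψ :=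
      fun _ => Iff.rfl
    refine ⟨V, fun φ hφ => ?_, fun ψ hgs => ?_, fun φ hφ u hu hw => ?_⟩
    · -- ORDER on `V`: normalise and use the uniform bound
      rw [hmem] at hφ
      by_cases h0 : φ = 0
      · subst h0; simp [Literature.MathematicalPhysics.QuantumLattice.expect]
      obtain ⟨a, ha0, ha1⟩ := exists_smul_unit h0
      have hgs : IsGroundStateInSector H N 0 (a • φ) :=
        ⟨Submodule.smul_mem _ a hφ.1, smul_ne_zero ha0 h0, by rw [mulVec_smul, hφ.2, smul_comm]⟩
      have hb' := hb n hn hL (a • φ) ha1 hgs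
      have haa : star a * a = ((‖a‖ ^ 2 : ℝ) : ℂ) := by
        rw [Complex.star_def, Complex.conj_mul']; push_cast; rfl
      rw [PosSemidefTrace.expect_conjTranspose_mul, mulVec_smul, star_smul, smul_dotProduct,
        dotProduct_smul, smul_smul, haa, smul_eq_mul, Complex.re_ofReal_mul] at hb'
      rw [star_smul, smul_dotProduct, dotProduct_smul, smul_smul, haa, smul_eq_mul] at ha1
      have h1 : ‖a‖ ^ 2 * (star φ ⬝ᵥ φ).re = 1 := by
        have := congrArg Complex.re ha1
        rwa [Complex.re_ofReal_mul, Complex.one_re] at this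
      have hpos : 0 < ‖a‖ ^ 2 := by positivity
      rw [PosSemidefTrace.expect_conjTranspose_mul]
      refine le_of_mul_le_mul_left ?_ hpos
      calc ‖a‖ ^ 2 * (c * ((n + 1 : ℕ) : ℝ) ^ 4 * (star φ ⬝ᵥ φ).re)
          = c * ((n + 1 : ℕ) : ℝ) ^ 4 * (‖a‖ ^ 2 * (star φ ⬝ᵥ φ).re) := by ring
        _ = c * ((n + 1 : ℕ) : ℝ) ^ 4 := by rw [h1, mul_one]
        _ ≤ _ := hb'
    · -- COVER: a ground state is not orthogonal to itself
      refine ⟨ψ, (hmem ψ).2 ⟨hgs.1, hgs.2.2⟩, fun h => hgs.2.1 ?_⟩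
      exact dotProduct_star_self_eq_zero.1 h
    · -- CLOSENESS: `φ - u ∈ V` and `⊥ V`, hence zero
      rw [hmem] at hφ
      have hwS : φ - u ∈ szSector N 0 := Submodule.sub_mem _ hφ.1 hu.1
      have hwE : H *ᵥ (φ - u) = ((H.minEnergyOn (szSector N 0) : ℝ) : ℂ) • (φ - u) := by
        rw [mulVec_sub, hφ.2, hu.2.2, smul_sub]
      have h0 : φ - u = 0 := by
        by_contra hne
        exact hne (dotProduct_star_self_eq_zero.1 (hw (φ - u) ⟨hwS, hne, hwE⟩))
      rw [h0]
      simp only [star_zero, zero_dotProduct, Complex.zero_re]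
      exact mul_nonneg (by positivity) (Complex.nonneg_iff.mp (dotProduct_star_self_nonneg _)).1
  · rintro ⟨U, hU, δ, hδ, c, hc, L₀, hb⟩
    refine ⟨U, hU, δ, hδ, c / 4, by positivity, L₀, fun n hn hL φ hφ1 hgs => ?_⟩
    obtain ⟨T, hord, hcover, hclose⟩ := hb n hn hL
    have h := groundState_dWave_order_of_closeTrialSubspace (L := n + 1) 1 U _ c (c / 1600)
      (by linarith) dWaveFormFactor GaugeTwist.abs_dWaveFormFactor_le_one _ T
      (fun φ hφ => by rw [← PosSemidefTrace.expect_conjTranspose_mul]; exact hord φ hφ)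
      (fun ψ hψS hψ hperp => by
        by_contra h0
        obtain ⟨φ', hφ', hne⟩ := hcover ψ ⟨hψS, h0, hψ⟩
        exact hne (hperp φ' hφ'))
      (fun φ hφ u huS hu0 hu hw => hclose φ hφ u ⟨huS, hu0, hu⟩ fun ψ' h' => hw ψ' h'.1 h'.2.2)
      φ hgs.1 hgs.2.2
    rw [hφ1, Complex.one_re, mul_one] at h
    rw [PosSemidefTrace.expect_conjTranspose_mul]
    exact h

/-- **The variational blueprint implies the summit.** If for some `U > 0`, `δ ∈ (0,1/2)`, `c > 0`,
`L₀`, at every even side `L = n+1 ≥ L₀` — with `H = hubbardTorus 2 L 1 U`, `S` the sector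
`(2⌊(1-δ)L²/2⌋, S^z = 0)`, `E₀ = minEnergyOn H S` — there are a trial subspace `T ≤ S` and `η`,
`γ > 0` with `1600η ≤ cγ` such that: (ORDER) `cL⁴‖φ‖² ≤ re⟨φ, (√2Δ_d)†(√2Δ_d)φ⟩` on `T`; (ENERGY)
`re⟨φ,Hφ⟩ - E₀‖φ‖² ≤ η‖φ‖²` on `T`; (GAP) `γ‖w‖² ≤ re⟨w,Hw⟩ - E₀‖w‖²` for every `w ∈ S` orthogonal
to all sector ground states; (COVER) every sector ground state overlaps `T` — then
`HubbardSuperconductivity`. [this work] -/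
theorem hubbardSuperconductivity_of_trialSubspaces
    (h : ∃ U : ℝ, 0 < U ∧ ∃ δ ∈ Set.Ioo (0 : ℝ) (1 / 2), ∃ c : ℝ, 0 < c ∧ ∃ L₀ : ℕ,
      ∀ n : ℕ, Even (n + 1) → L₀ ≤ n + 1 →
        ∃ (T : Submodule ℂ (Fock (Orb (FermionTorus 2 (n + 1))))) (η γ : ℝ), 0 < γ ∧
          1600 * η ≤ c * γ ∧
          T ≤ szSector (Λ := FermionTorus 2 (n + 1)) (2 * ⌊(1 - δ) * ((n + 1 : ℕ) : ℝ) ^ 2 / 2⌋₊)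
            0 ∧
          (∀ φ ∈ T, c * ((n + 1 : ℕ) : ℝ) ^ 4 * (star φ ⬝ᵥ φ).re ≤ (expect
            ((pairField dWaveFormFactor (n + 1))ᴴ * pairField dWaveFormFactor (n + 1)) φ).re) ∧
          (∀ φ ∈ T, (star φ ⬝ᵥ (hubbardTorus 2 (n + 1) 1 U *ᵥ φ)).re -
              (hubbardTorus 2 (n + 1) 1 U).minEnergyOn
                (szSector (2 * ⌊(1 - δ) * ((n + 1 : ℕ) : ℝ) ^ 2 / 2⌋₊) 0) * (star φ ⬝ᵥ φ).re ≤
            η * (star φ ⬝ᵥ φ).re) ∧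
          (∀ w ∈ szSector (Λ := FermionTorus 2 (n + 1))
              (2 * ⌊(1 - δ) * ((n + 1 : ℕ) : ℝ) ^ 2 / 2⌋₊) 0,
            (∀ ψ, IsGroundStateInSector (hubbardTorus 2 (n + 1) 1 U)
              (2 * ⌊(1 - δ) * ((n + 1 : ℕ) : ℝ) ^ 2 / 2⌋₊) 0 ψ → star ψ ⬝ᵥ w = 0) →
            γ * (star w ⬝ᵥ w).re ≤ (star w ⬝ᵥ (hubbardTorus 2 (n + 1) 1 U *ᵥ w)).re -
              (hubbardTorus 2 (n + 1) 1 U).minEnergyOn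
                (szSector (2 * ⌊(1 - δ) * ((n + 1 : ℕ) : ℝ) ^ 2 / 2⌋₊) 0) * (star w ⬝ᵥ w).re) ∧
          (∀ ψ, IsGroundStateInSector (hubbardTorus 2 (n + 1) 1 U)
              (2 * ⌊(1 - δ) * ((n + 1 : ℕ) : ℝ) ^ 2 / 2⌋₊) 0 ψ → ∃ φ ∈ T, star φ ⬝ᵥ ψ ≠ 0)) :
    HubbardSuperconductivity := by
  obtain ⟨U, hU, δ, hδ, c, hc, L₀, hb⟩ := h
  refine hubbardSuperconductivity_of_uniform_dWave_bound
    ⟨U, hU, δ, hδ, c / 4, by positivity, L₀, fun n hn hL φ hφ1 hgs => ?_⟩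
  obtain ⟨T, η, γ, hγ, hηγ, hTS, hord, hen, hgap, hcover⟩ := hb n hn hL
  have h := groundState_dWave_order_of_trialSubspace (L := n + 1) 1 U _ c η γ hγ hηγ
    dWaveFormFactor GaugeTwist.abs_dWaveFormFactor_le_one _ T hTS hen
    (fun φ hφ => by rw [← PosSemidefTrace.expect_conjTranspose_mul]; exact hord φ hφ)
    (fun w hwS hw => hgap w hwS fun ψ h' => hw ψ h'.1 h'.2.2)
    (fun ψ hψS hψ hperp => by
      by_contra h0
      obtain ⟨φ', hφ', hne⟩ := hcover ψ ⟨hψS, h0, hψ⟩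
      exact hne (hperp φ' hφ'))
    φ hgs.1 hgs.2.2
  rw [hφ1, Complex.one_re, mul_one] at h
  rw [PosSemidefTrace.expect_conjTranspose_mul]
  exact h

end Summit.HubbardSuperconductivity.HubbardSuperconductivity.Theorems
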